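import Mathlib
import Summits.ValiantsHypothesis.ValiantsHypothesis.Theses.FeketeSOS

/-!
# Sketch — crux-ideate `witt-jordan-staircase` for `FeketeSOS.FeketeBoundedFanin`
(planner-cruxidea-stmt-ValiantsHypothesis-3998-1-0, round 1, ideator 1)

First checkable statements of the line (all `Prop` defs; nothing is proved here except the
trivial glue at the end).  Notation: `fekete R p = Σ_{m<p} (m|p) X^m`, `N = (p-1)/2`,
`y = X - 1`; "cyclic" identities are divisibility by `X^p - 1 = (X-1)^p` in characteristic `p`.
-/

open Polynomial Finset BigOperators

namespace Summit.ValiantsHypothesis.ValiantsHypothesis.Cruxes.FeketeBoundedFanin.WittJordan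

/-- The Fekete polynomial with coefficients pushed into a ring `R`. -/
noncomputable def fekete (R : Type*) [Ring R] (p : ℕ) [Fact p.Prime] : R[X] :=
  ∑ m ∈ Finset.range p, C (((legendreSym p (m : ℤ)) : ℤ) : R) * X ^ m

/-- Support-sum of a family of polynomials. -/
noncomputable def suppSum {R : Type*} [Semiring R] {s : ℕ} (g : Fin s → R[X]) : ℕ :=
  ∑ i, (g i).support.card

/-- (R) Orthogonal re-basing is free for bounded fan-in: rewriting `Σ cᵢ gᵢ²` in any other
orthogonal basis of the quadratic space `⟨c⟩` gives a representation of the same polynomial whose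
new polynomials are linear combinations of the old ones (so each new support lies in the union of
the old supports, and the support-sum grows by a factor ≤ s). -/
def Rebase : Prop :=
  ∀ (K : Type) [Field K] (s : ℕ) (c c' : Fin s → K) (P : Matrix (Fin s) (Fin s) K)
    (g : Fin s → K[X]),
    P.transpose * Matrix.diagonal c * P = Matrix.diagonal c' → IsUnit P.det →
      (∑ j, C (c' j) * (fun j => ∑ i, C (P⁻¹ j i) * g i) j ^ 2) = ∑ i, C (c i) * g i ^ 2 ∧
      ∀ j, ((fun j => ∑ i, C (P⁻¹ j i) * g i) j).support ⊆ Finset.univ.biUnion fun i => (g i).support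

/-- (H) char-`p` Hajós / MDS lemma (shared with the sibling crux FeketeNoSparseSplit): a nonzero
polynomial of degree `< p` over a field of characteristic `p` divisible by `(X-1)^m` has at least
`m+1` monomials. -/
def CharPHajos : Prop :=
  ∀ (K : Type) [Field K] (p : ℕ) [Fact p.Prime] [CharP K p] (g : K[X]) (m : ℕ),
    g ≠ 0 → g.natDegree < p → (X - C 1) ^ m ∣ g → m + 1 ≤ g.support.card

/-- (E) Euler/MNT: in characteristic `p` (odd) the Fekete polynomial vanishes at `1` to order
exactly `N = (p-1)/2`. -/
def FeketeOrderAtOne : Prop :=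
  ∀ (K : Type) [Field K] (p : ℕ) [Fact p.Prime] [CharP K p], p ≠ 2 →
    (X - C 1) ^ ((p - 1) / 2) ∣ fekete K p ∧ ¬ (X - C 1) ^ ((p - 1) / 2 + 1) ∣ fekete K p

/-- **First lemma (A): the aligned level is linear.**  In a cyclic char-`p` representation
`Σ cᵢ ḡᵢ² ≡ u·F̄_p (mod X^p - 1)`, `u ≠ 0`, let `o` be a lower bound for the orders at `X = 1`
of the live polynomials (`cᵢ ≠ 0`, `ḡᵢ ≠ 0`).  If the leading Taylor coefficients at level `o`
do NOT cancel in the quadratic form, then `2o = N`, and every live `ḡᵢ` has order `≥ N/2`, hence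
(Hajós) at least `(p+3)/4` monomials — a LINEAR bound.  (For `p ≡ 3 (mod 4)` the hypothesis is
never satisfied: cancellation at the lowest level is forced.) -/
def AlignedLevelLinear : Prop :=
  ∀ (K : Type) [Field K] (p : ℕ) [Fact p.Prime] [CharP K p], p ≠ 2 →
  ∀ (s : ℕ) (c : Fin s → K) (g : Fin s → K[X]) (u : K), u ≠ 0 →
    (∀ i, (g i).natDegree < p) →
    (X ^ p - 1 ∣ (∑ i, C (c i) * g i ^ 2) - C u * fekete K p) →
    ∀ o : ℕ, (∀ i, c i ≠ 0 → g i ≠ 0 → o ≤ (g i).rootMultiplicity 1) →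
      (∑ i ∈ Finset.univ.filter (fun i => (g i).rootMultiplicity 1 = o),
          c i * ((taylor 1 (g i)).coeff o) ^ 2) ≠ 0 →
      2 * o = (p - 1) / 2 ∧ ∀ i, c i ≠ 0 → g i ≠ 0 → (p + 3) / 4 ≤ (g i).support.card

/-- (B) Rank-two blocks are linear.  If two `k`-linearly independent polynomials of degree `< p`
are exactly isotropic cyclically, `X^p - 1 ∣ c₀ g₀² + c₁ g₁²` (`c₀ c₁ ≠ 0`, `k` algebraically
closed of characteristic `p`), then `p + 2 ≤ 2 (|supp g₀| + |supp g₁|)`: the binary form factors,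
linear independence makes both factors nonzero, their orders at `1` add up to `≥ p`, and Hajós
converts order into monomials.  (This is the top-level "cancelling" case for a Jordan block of
rank 2; independence is automatic in a Jordan-adapted basis, see the card.) -/
def RankTwoBlockLinear : Prop :=
  ∀ (K : Type) [Field K] [IsAlgClosed K] (p : ℕ) [Fact p.Prime] [CharP K p], p ≠ 2 →
  ∀ (c : Fin 2 → K) (g : Fin 2 → K[X]), c 0 ≠ 0 → c 1 ≠ 0 →
    (∀ i, (g i).natDegree < p) → LinearIndependent K g →
    (X ^ p - 1 ∣ ∑ i, C (c i) * g i ^ 2) →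
    p + 2 ≤ 2 * ((g 0).support.card + (g 1).support.card)

/-- (T) The socle tiling — WHY ORDER ALONE CANNOT WORK for `s₀ ≥ 3`.  Over any commutative ring,
`1 + X·(Σ_{i<a} X^i)·(Σ_{j<b} X^{aj}) = Σ_{m ≤ ab} X^m` (two geometric series tile the interval `[1, ab]`).
With `ab = p − 1` in characteristic `p` the right side is `(X^p − 1)/(X − 1) = (X − 1)^{p−1}`: the rank-3
split form `DE + h²` at `D = X + ⋯ + X^a`, `E = 1 + X^a + ⋯ + X^{a(b−1)}`, `h = 1` has support-sum
`a + b + 1 ≈ 2√p` and vanishes at `X = 1` to order `p − 1` WITHOUT vanishing cyclically.  So the order-only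
"Staircase Lemma" (deep approximate isotropy ⇒ cyclic isotropy) is FALSE for rank ≥ 3, and applying `ϑ = X·d/dX`
`j` times gives order `p − 1 − j` with fan-in `2(j+1)`: the whole "socle zone" is cheap.  Any proof must use that
the order of `u·F̄_p` is EXACTLY `N = (p−1)/2` — a MIDDLE order — not merely `≥ N`. -/
def SocleTiling : Prop :=
  ∀ (R : Type) [CommRing R] (a b : ℕ),
    (1 : R[X]) + X * (∑ i ∈ Finset.range a, X ^ i) * (∑ j ∈ Finset.range b, X ^ (a * j)) =
      ∑ m ∈ Finset.range (a * b + 1), X ^ m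

/-- **The open heart, corrected: the Staircase GAP `SL♯(s, η, A, B)`.**  For a symmetric `s × s` matrix `Q`
over a field of characteristic `p` and polynomials `gᵢ` of degree `< p` with support-sum `T`, the EXACT order of
vanishing of `Q(g) = Σ Qᵢⱼ gᵢ gⱼ` at `X = 1` is never in the middle range `[A·T^{2−η}, p − 1 − B]`: it is either
small (genuine fewnomial behaviour; `≤ 2T` conjecturally) or within `B = B(s)` of the socle (Frobenius/tiling
behaviour: the coefficient function is then a polynomial of degree `≤ B` on `𝔽_p`).  True for `s ≤ 2` with
`η = 1, B = 0`; open for `s ≥ 3`; ANY `η > 0` (with any `B`) gives the depth-0 crux, whose target has exact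
order `N = (p−1)/2`. -/
def StaircaseGap (s : ℕ) (η A : ℝ) (B : ℕ) : Prop :=
  ∀ (K : Type) [Field K] (p : ℕ) [Fact p.Prime] [CharP K p],
  ∀ (Q : Matrix (Fin s) (Fin s) K) (g : Fin s → K[X]) (m : ℕ),
    (∀ i, (g i).natDegree < p) →
    A * (suppSum g : ℝ) ^ (2 - η) ≤ (m : ℝ) → m + B < p →
    (X - C 1) ^ m ∣ ∑ i, ∑ j, C (Q i j) * g i * g j →
    ¬ (X - C 1) ^ (m + 1) ∣ ∑ i, ∑ j, C (Q i j) * g i * g j → False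

/-- (NC) The non-cancelling (𝔭-adic depth 0) branch of the crux follows from the Staircase Gap
with ANY power saving (for `p > 2B + 1`): a cyclic char-`p` representation of `u·F̄_p` (`u ≠ 0`) by a quadratic form
in `s` polynomials of degree `< p` has support-sum `≥ (N/A)^{1/(2-η)}`, i.e. `p^{1/2+δ}` with
`δ = η/(4-2η) > 0`. -/
def NCBranch (s : ℕ) (η A : ℝ) : Prop :=
  ∃ p₀ : ℕ, ∀ (K : Type) [Field K] (p : ℕ) [Fact p.Prime] [CharP K p], p ≠ 2 → p₀ ≤ p →
  ∀ (Q : Matrix (Fin s) (Fin s) K) (g : Fin s → K[X]) (u : K), u ≠ 0 →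
    (∀ i, (g i).natDegree < p) →
    (X ^ p - 1 ∣ (∑ i, ∑ j, C (Q i j) * g i * g j) - C u * fekete K p) →
    (((p : ℝ) - 1) / 2 / A) ^ (1 / (2 - η)) ≤ (suppSum g : ℝ)

/-- The reduction `SL♯ ⇒ NC` (valuation bookkeeping + `FeketeOrderAtOne`: `Q(ḡ) ≡ u·F̄_p (mod X^p − 1)`
with `u ≠ 0` has EXACT order `N` at `1`, a middle order for `p > 2B + 1`). -/
def SLImpliesNC : Prop :=
  ∀ (s : ℕ) (η A : ℝ) (B : ℕ), 0 < A → 0 < η → η ≤ 1 →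
    FeketeOrderAtOne → StaircaseGap s η A B → NCBranch s η A

/-- (J) Jordan-adapted integral reduction (the 𝔭-adic normal form).  A complex representation with
fan-in `s` descends to a number field; at a prime `𝔭 ∣ p`, in a Jordan-adapted orthogonal basis of
the coefficient lattice, the reduction of the TOP Jordan block is either (depth 0) a cyclic char-`p`
representation of `u·F̄_p`, `u ≠ 0`, or (depth > 0) a nonzero EXACTLY isotropic cyclic configuration
whose nonzero polynomials are `k`-linearly independent — in both cases with at most `s` polynomials
whose supports sit inside the original ones. -/
def JordanReduction : Prop :=
  ∀ (s : ℕ) (p : ℕ) [Fact p.Prime], p ≠ 2 →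
  ∀ (c : Fin s → ℂ) (g : Fin s → ℂ[X]),
    (∑ i, C (c i) * g i ^ 2) = fekete ℂ p →
    ∃ (K : Type) (_ : Field K) (_ : CharP K p) (_ : IsAlgClosed K)
      (Q : Matrix (Fin s) (Fin s) K) (gb : Fin s → K[X]),
      (∀ i, (gb i).natDegree < p) ∧ (∀ i, (gb i).support.card ≤ (g i).support.card) ∧
      -- supports only shrink (cyclic folding + reduction); re-basing bounded by `Rebase`
      (suppSum gb ≤ s * suppSum g) ∧
      ((∃ u : K, u ≠ 0 ∧ X ^ p - 1 ∣ (∑ i, ∑ j, C (Q i j) * gb i * gb j) - C u * fekete K p) ∨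
       ((∃ i, gb i ≠ 0) ∧ LinearIndependent K (fun i : {i // gb i ≠ 0} => gb i.1) ∧
          Q.det ≠ 0 ∧ X ^ p - 1 ∣ ∑ i, ∑ j, C (Q i j) * gb i * gb j))

/-- (D) The depth branch — what the line still owes after `SL♯`: an exactly isotropic, linearly
independent, nondegenerate cyclic configuration of `≤ s` sparse polynomials cannot be the top Jordan
block of a cheap representation of `F_p`.  Stated here in the crude sufficient form "such
configurations are themselves expensive OR the representation below them is"; the card explains why
the naive form (expensive by themselves) is FALSE (Pythagorean monomial triples) and what structure
(rational curves on smooth quadrics ⇒ Pythagorean/Segre parametrisations) a proof must use. -/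
def DepthBranch (s : ℕ) (δ : ℝ) : Prop :=
  ∃ p₀ : ℕ, ∀ (p : ℕ) [Fact p.Prime], p₀ ≤ p →
  ∀ (c : Fin s → ℂ) (g : Fin s → ℂ[X]),
    (∀ i, (g i).natDegree ≤ p ^ 2) →
    (∑ i, C (c i) * g i ^ 2) = fekete ℂ p →
    -- "the 𝔭-adic depth of the Gram lattice is 0, or the support-sum is already large"
    (∃ (K : Type) (_ : Field K) (_ : CharP K p) (Q : Matrix (Fin s) (Fin s) K)
        (gb : Fin s → K[X]) (u : K), u ≠ 0 ∧ (∀ i, (gb i).natDegree < p) ∧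
        suppSum gb ≤ s * suppSum g ∧
        X ^ p - 1 ∣ (∑ i, ∑ j, C (Q i j) * gb i * gb j) - C u * fekete K p) ∨
    (p : ℝ) ^ (1 / 2 + δ) ≤ (suppSum g : ℝ)

/-- Glue (checked): the two branches give the crux.  `NCBranch` for every `s` with a fixed power
saving, plus `DepthBranch`, imply `FeketeBoundedFanin`. Stated as a Prop; the proof is real-number
bookkeeping (`suppSum gb ≤ s·suppSum g`, `((p-1)/2/A)^{1/(2-η)} ≥ p^{1/2+δ}/… for large p`). -/
def BranchesImplyCrux : Prop :=
  ∀ (η A : ℝ), 0 < η → η ≤ 1 → 0 < A →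
    (∀ s, NCBranch s η A) → (∀ s, ∃ δ : ℝ, 0 < δ ∧ DepthBranch s δ) →
    Summit.ValiantsHypothesis.ValiantsHypothesis.Theses.FeketeSOS.FeketeBoundedFanin

/-! ## Generation-2 additions (planner-cruxidea-stmt-ValiantsHypothesis-3998-1-g2-0, 2026-08-16)

Three calibration statements used by the revised card (all `Prop` defs; they only need to elaborate).
-/

/-- (Z) The ζ-component split.  `ℤ[X]/(X^p − 1)` is the fibre product `ℤ ×_{𝔽_p} ℤ[ζ_p]`: a cyclic
integer identity is the pair (identity at `X = 1`, identity modulo `Φ_p`).  In particular every cyclic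
representation of `F_p` is ONE equation `Σ cᵢ gᵢ(ζ)² = G` (Gauss sum, `v_p(G) = 1/2`) between ζ-sparse
cyclotomic integers, plus the scalar equation `Σ cᵢ gᵢ(1)² = 0`; the socle phenomena of the card
(`SocleTiling`: `1 + X·A·B = Φ_p`, order `p − 1` at `1` in characteristic `p`) live on the `X = 1` side —
on the ζ-side they read `1 + ζ A(ζ) B(ζ) = 0`, a UNIT equation, invisible to the Gauss sum. -/
def ZetaComponentSplit : Prop :=
  ∀ (p : ℕ) [Fact p.Prime] (A : ℤ[X]),
    (X ^ p - 1 ∣ A) ↔ ((X - C 1 ∣ A) ∧ (Polynomial.cyclotomic p ℤ ∣ A))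

/-- (W) Teichmüller exactness of the target to the second `p`-adic digit: `χ_p(n) = ω(n)^N` on the nose
(`ω` = Teichmüller), hence `χ_p(n) ≡ n^{pN} (mod p²)` — the target `F_p` has ALL higher Witt digits zero,
its first correction against the naive lift `Σ n^N X^n` being the Fermat-quotient twist `p·N·Σ n^N q(n) X^n`.
(Used only to show that the "second digit" carries no obstruction on the target side; the gen-2 Hensel
experiment `exp/lift_test.py`, `exp/full_lift.py` shows the solution side is porous too — see the card.) -/
def LegendreTeichmuellerSq : Prop :=
  ∀ (p : ℕ) [Fact p.Prime], p ≠ 2 → ∀ n : ℤ,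
    (legendreSym p n : ℤ) ≡ n ^ (p * ((p - 1) / 2)) [ZMOD ((p : ℤ) ^ 2)]

/-- (Jc) Jacobi calibration of the depth branch.  For `p ≡ 1 (mod 4)` and a quartic character `ψ`
(`ψ² = χ_p`), the cyclic identity `Ψ² ≡ J(ψ,ψ)·F_p (mod X^p − 1)` holds with `Ψ = Σ ψ(m) X^m` (dense):
at the prime `π ∣ p` of `ℤ[i]` dividing `J(ψ,ψ)` the one-square representation `F_p ≡ J⁻¹ Ψ²` has
𝔭-adic DEPTH 1 with a cyclically nilpotent top block (`ord₁ Ψ̄ = 3(p−1)/4`, so `Ψ̄² ≡ 0 mod (X−1)^p`),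
while at `π̄` it has depth 0 and is ALIGNED (`2·ord₁ Ψ̄ = N`, the equality case of `AlignedLevelLinear`).
Both branches of `JordanReduction` therefore occur in nature for the same global object. -/
def JacobiSquare : Prop :=
  ∀ (p : ℕ) [Fact p.Prime], p % 4 = 1 →
  ∀ ψ : MulChar (ZMod p) ℂ, (∀ m : ZMod p, ψ m * ψ m = ((legendreSym p (m.val : ℤ) : ℤ) : ℂ)) →
    X ^ p - 1 ∣ (∑ m ∈ Finset.range p, C (ψ (m : ZMod p)) * X ^ m) ^ 2 - C (jacobiSum ψ ψ) * fekete ℂ p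

/-- Sanity glue actually proved here: the crux decl is the one in the route file. -/
example : Summit.ValiantsHypothesis.ValiantsHypothesis.Theses.FeketeSOS.FeketeBoundedFanin =
    (∀ s₀ : ℕ, ∃ δ : ℝ, 0 < δ ∧ ∃ p₀ : ℕ, ∀ (p : ℕ) [Fact p.Prime], p₀ ≤ p →
      ∀ (c : Fin s₀ → ℂ) (g : Fin s₀ → Polynomial ℂ), (∀ i, (g i).natDegree ≤ p ^ 2) →
      (∑ i, Polynomial.C (c i) * g i ^ 2) =
        ∑ m ∈ Finset.range p, Polynomial.C ((legendreSym p m : ℤ) : ℂ) * Polynomial.X ^ m →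
      (p : ℝ) ^ (1 / 2 + δ) ≤ ∑ i, ((g i).support.card : ℝ)) := rfl

end Summit.ValiantsHypothesis.ValiantsHypothesis.Cruxes.FeketeBoundedFanin.WittJordan
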